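import Summits.BirchSwinnertonDyer.BirchSwinnertonDyer.Theorems.KimAtThreeFineKatoKPortJunctionLog
import Summits.BirchSwinnertonDyer.BirchSwinnertonDyer.Theorems.KimAtThreeEulerLatticeIndex
import Literature.NumberTheory.EllipticCurves.PadicLogEulerLatticeProofs
import Literature.NumberTheory.EllipticCurves.EulerLatticeReductionCountProofs
import Literature.NumberTheory.EllipticCurves.BSDQuadraticDescentTorsionOddPartProofs
import HarnessLib

/-!
# The E-side lattice lemma `log_ω E(L_w) = E_p(φ)⁻¹𝒪_w` at a good unramified prime

Helper for the W2 crux `KimAtThreeKolyvagin.DeepLowerAtThreeOffKatoStratum` (the good-anomalous rows of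
`stub_additiveDefect`, via the support statement `FineKatoTauAnomalousThree`): the only non-kernel
algebraic input of the local Bloch–Kato computation, in the currency of the cell's `p`-adic port
(`KPort.Kw p L w`, the completion `L_w` with the base-`p` norm and its `ℚ_[p]`-algebra structure).

Setting: `W/ℚ` globally minimal, `p ∤ Δ_min(W)` (good reduction), `L` a number field, `w ∣ p` a place
with `e(w∣p) = 1` and residue degree `f = [L_w : ℚ_p]`, `φ : K_w →ₐ[ℚ_p] K_w` isometric, lifting
`x ↦ x^p`, with `φ^f = 1` and `φ⁰,…,φ^{f-1}` pairwise distinct (the Frobenius of `L_w/ℚ_p`), and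
`E_p(X) = X² − a_pX + p`, `a_p = W.frobeniusTrace p`.

* `norm_eulerOperator_padicLog_le` — `⊆`: `‖E_p(φ)·log_ω P‖ ≤ ‖p‖`-form for every `P ∈ E(L_w)`
  (from `EulerLattice.norm_frobeniusCombination_padicLog_le`).
* `exists_padicLog_eq_of_norm_eulerOperator_le` — `⊇` when `E(L_w)[p] = 0`: every `y` with
  `‖φφy − a_pφy + py‖ ≤ ‖p‖` is a `log_ω P`.  Assembly: the count
  `EulerLattice.exists_padicLog_eq_of_mem_eulerLattice` (modulo an index hypothesis), the index
  `KimAtThreeEulerLatticeIndex.relIndex_integer_eulerLattice` (base-`p` norm; transported along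
  `K_w = L_w` and the scaling `t ↦ p·t`), and the point count
  `EulerLattice.natCard_point_reduction_model` (`#Ẽ(k_w) = p^f + 1 − D_f(a_p; p)`).
* `exists_padicLog_eq_iff_norm_eulerOperator_le` — the equality as an `iff`.

Transport lemmas between Mathlib's norm on `w.1.adicCompletion L` (base `N(w)`) and the port's
(base `p`): `norm_le_norm_iff`, `norm_lt_norm_iff`, `norm_le_one_iff'`,
`norm_le_norm_natCast_of_norm_lt_one`, `norm_conj_eq`, `norm_conj_sub_pow_lt`.

References: Bloch–Kato, *L-functions and Tamagawa numbers of motives* (1990), Example 3.11;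
Silverman, *The Arithmetic of Elliptic Curves* (2009), IV.6.4, V.2.3.1, VII.2–3.
-/

noncomputable section

-- the cell's Theorems namespace repeats the summit name by design (D-0017)
set_option linter.dupNamespace false

open scoped Classical NNReal NumberField
open IsDedekindDomain NumberField Polynomial
open _root_.WeierstrassCurve Literature.NumberTheory.EllipticCurves
  Literature.NumberTheory.EllipticCurves.FormalGroupChart Literature.NumberTheory.EllipticCurves.EulerLattice
open Summit.BirchSwinnertonDyer.BirchSwinnertonDyer.Theorems.KPort
open Summit.BirchSwinnertonDyer.BirchSwinnertonDyer.Theorems.KimAtThreeEulerLatticeIndex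
open Summit.BirchSwinnertonDyer.BirchSwinnertonDyer.Theorems.KimAtThreeEulerOperatorDeterminant

namespace Summit.BirchSwinnertonDyer.BirchSwinnertonDyer.Theorems.KimAtThreeEulerLatticeOfFrobenius

variable (p : ℕ) [hp : Fact p.Prime] (L : Type) [Field L] [NumberField L]
  (w : ((Rat.HeightOneSpectrum.primesEquiv (R := 𝓞 ℚ)).symm ⟨p, hp.out⟩).Extension (𝓞 L))

/-- The two norms on `L_w` (Mathlib's, base `N(w)`, and the synonym's, base `p`) are both monotone in the
`w`-adic valuation: `‖x‖ ≤ ‖y‖` holds for one iff for the other. [folklore] -/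
theorem norm_le_norm_iff (x y : w.1.adicCompletion L) :
    ‖x‖ ≤ ‖y‖ ↔ ‖(Kw.toCompletion p L w).symm x‖ ≤ ‖(Kw.toCompletion p L w).symm y‖ := by
  rw [Valued.toNormedField.norm_le_iff, Valued.toNormedField.norm_le_iff]
  rfl

/-- Strict version of `norm_le_norm_iff`. [folklore] -/
theorem norm_lt_norm_iff (x y : w.1.adicCompletion L) :
    ‖x‖ < ‖y‖ ↔ ‖(Kw.toCompletion p L w).symm x‖ < ‖(Kw.toCompletion p L w).symm y‖ := by
  rw [Valued.toNormedField.norm_lt_iff, Valued.toNormedField.norm_lt_iff]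
  rfl

/-- `‖x‖ ≤ 1` for one norm iff for the other (both unit balls are `𝒪_w`). [folklore] -/
theorem norm_le_one_iff' (x : w.1.adicCompletion L) :
    ‖x‖ ≤ 1 ↔ ‖(Kw.toCompletion p L w).symm x‖ ≤ 1 := by
  rw [Valued.toNormedField.norm_le_one_iff, Valued.toNormedField.norm_le_one_iff]
  rfl

/-- In the unramified case `e(w∣p) = 1`, `p` is a uniformiser of `L_w`: `‖x‖ < 1 ⇒ ‖x‖ ≤ ‖p‖` in
Mathlib's norm on `L_w` (transport of `KPort.Kw.norm_le_norm_prime_of_norm_lt_one`). [folklore] -/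
theorem norm_le_norm_natCast_of_norm_lt_one [he : Fact (w.1.asIdeal.ramificationIdx (𝓞 ℚ) = 1)]
    (x : w.1.adicCompletion L) (hx : ‖x‖ < 1) : ‖x‖ ≤ ‖(p : w.1.adicCompletion L)‖ := by
  rw [norm_le_norm_iff p L w]
  have hx' : ‖(Kw.toCompletion p L w).symm x‖ < 1 := by
    have h := (norm_lt_norm_iff p L w x 1).mp (by rwa [norm_one])
    rwa [map_one, norm_one] at h
  exact Kw.norm_le_norm_prime_of_norm_lt_one he.out ((Kw.toCompletion p L w).symm x) hx'

/-- An isometry `φ` of `K_w` (base-`p` norm), read on `L_w` through the identity `K_w = L_w`, is an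
isometry of Mathlib's norm. [folklore] -/
theorem norm_conj_eq (φ : Kw p L w →ₐ[ℚ_[p]] Kw p L w) (hφ : ∀ x, ‖φ x‖ = ‖x‖)
    (φK : w.1.adicCompletion L → w.1.adicCompletion L)
    (hφK : ∀ x, φK x = Kw.toCompletion p L w (φ ((Kw.toCompletion p L w).symm x)))
    (x : w.1.adicCompletion L) : ‖φK x‖ = ‖x‖ := by
  rw [hφK]
  refine le_antisymm ?_ ?_
  · rw [norm_le_norm_iff p L w, RingEquiv.symm_apply_apply, hφ]
  · rw [norm_le_norm_iff p L w, RingEquiv.symm_apply_apply, hφ]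

/-- A lift of Frobenius `φ` on `K_w` (`‖φ x − x^p‖ < 1` on the unit ball), read on `L_w` through the
identity `K_w = L_w`, lifts Frobenius for Mathlib's norm. [folklore] -/
theorem norm_conj_sub_pow_lt (φ : Kw p L w →ₐ[ℚ_[p]] Kw p L w)
    (hφp : ∀ x : Kw p L w, ‖x‖ ≤ 1 → ‖φ x - x ^ p‖ < 1)
    (φK : w.1.adicCompletion L → w.1.adicCompletion L)
    (hφK : ∀ x, φK x = Kw.toCompletion p L w (φ ((Kw.toCompletion p L w).symm x)))
    (x : w.1.adicCompletion L) (hx : ‖x‖ ≤ 1) : ‖φK x - x ^ p‖ < 1 := by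
  have h := hφp ((Kw.toCompletion p L w).symm x) ((norm_le_one_iff' p L w x).mp hx)
  have h2 := norm_lt_norm_iff p L w (φK x - x ^ p) 1
  rw [map_one, norm_one, norm_one] at h2
  rw [h2, map_sub, map_pow, hφK, RingEquiv.symm_apply_apply]
  exact h

variable (W : WeierstrassCurve ℚ) [W.IsElliptic] [W.IsGloballyMinimal]

omit [W.IsElliptic] in
/-- **The `⊆` half of the lattice lemma in the `K_w` currency.**  For `W/ℚ` globally minimal with
`p ∤ Δ_min(W)`, `w ∣ p` unramified, and `φ` an isometric `ℚ_p`-algebra endomorphism of `K_w` lifting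
`x ↦ x^p`: for every `P ∈ E(L_w)`, `y = log_ω P` satisfies `‖φφy − a_p·φy + p·y‖ ≤ ‖p‖`, i.e.
**`log_ω E(L_w) ⊆ (p·E_p(φ))⁻¹(p𝒪_w) = E_p(φ)⁻¹𝒪_w`** (`E_p(X) = X² − a_pX + p`,
`a_p = W.frobeniusTrace p`).  Transport of `EulerLattice.norm_frobeniusCombination_padicLog_le` along
`K_w = L_w`. [cite: BlochKato1990, Example 3.11] [cite: SilvermanAEC2009, Thm. IV.6.4] -/
theorem norm_eulerOperator_padicLog_le [he : Fact (w.1.asIdeal.ramificationIdx (𝓞 ℚ) = 1)]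
    (hΔ : ¬ (p : ℤ) ∣ minimalDiscriminantInt W)
    (φ : Kw p L w →ₐ[ℚ_[p]] Kw p L w) (hφ : ∀ x, ‖φ x‖ = ‖x‖)
    (hφp : ∀ x : Kw p L w, ‖x‖ ≤ 1 → ‖φ x - x ^ p‖ < 1)
    (P : (W.baseChange (w.1.adicCompletion L)).toAffine.Point) :
    haveI := isIntegral_baseChange w.1 W
    ‖φ (φ ((Kw.toCompletion p L w).symm (padicLogPointFiniteExt (NormedField.valuation : Valuation (w.1.adicCompletion L) ℝ≥0) (W.baseChange (w.1.adicCompletion L)) p P)))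
        - (W.frobeniusTrace p : Kw p L w) * φ ((Kw.toCompletion p L w).symm (padicLogPointFiniteExt (NormedField.valuation : Valuation (w.1.adicCompletion L) ℝ≥0) (W.baseChange (w.1.adicCompletion L)) p P))
        + (p : Kw p L w) * (Kw.toCompletion p L w).symm (padicLogPointFiniteExt (NormedField.valuation : Valuation (w.1.adicCompletion L) ℝ≥0) (W.baseChange (w.1.adicCompletion L)) p P)‖ ≤ ‖(p : Kw p L w)‖ := by
  classical
  haveI hint := isIntegral_baseChange w.1 W
  have hw : ((p : ℕ) : 𝓞 L) ∈ w.1.asIdeal := Kw.prime_mem_asIdeal w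
  let φ₀ : w.1.adicCompletion L →+* w.1.adicCompletion L :=
    (Kw.toCompletion p L w).toRingHom.comp (φ.toRingHom.comp (Kw.toCompletion p L w).symm.toRingHom)
  let φK : w.1.adicCompletion L →ₐ[ℚ] w.1.adicCompletion L := φ₀.toRatAlgHom
  have hφK : ∀ x, φK x = Kw.toCompletion p L w (φ ((Kw.toCompletion p L w).symm x)) := fun _ => rfl
  have h := norm_frobeniusCombination_padicLog_le w.1 W hw hΔ (norm_le_norm_natCast_of_norm_lt_one p L w)
    φK (norm_conj_eq p L w φ hφ φK hφK) (norm_conj_sub_pow_lt p L w φ hφp φK hφK) P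
  rw [norm_le_norm_iff p L w, map_add, map_sub, map_mul, map_mul, map_intCast, map_natCast, hφK, hφK,
    RingEquiv.symm_apply_apply, RingEquiv.symm_apply_apply] at h
  exact h

/-- **The E-side lattice lemma on `L_w`, unramified `w ∣ p`, from the Frobenius data.**  Let `W/ℚ` be
globally minimal with `p ∤ Δ_min(W)`, `w` a place of the number field `L` over `p` with `e(w∣p) = 1`
and residue degree `f = [L_w : ℚ_p]`, and `φ` an isometric `ℚ_p`-algebra endomorphism of
`K_w = KPort.Kw p L w` lifting `x ↦ x^p`, with `φ^f = 1` and `φ⁰, …, φ^{f−1}` pairwise distinct (the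
Frobenius of the unramified `L_w/ℚ_p`).  If `E(L_w)` has no `p`-torsion, then every `y ∈ K_w` with
`‖φφy − a_p·φy + p·y‖ ≤ ‖p‖` (`a_p = W.frobeniusTrace p`) is `log_ω P` for some `P ∈ E(L_w)`:
**`log_ω E(L_w) ⊇ (p·E_p(φ))⁻¹(p𝒪_w)`**, the `⊇` half of `log_ω E(L_w) = E_p(φ)⁻¹𝒪_w`
(the `⊆` half is `EulerLattice.norm_frobeniusCombination_padicLog_le`).  Assembly of the tree:
`EulerLattice.exists_padicLog_eq_of_mem_eulerLattice` (the count, modulo the index hypothesis) with the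
index `KimAtThreeEulerLatticeIndex.relIndex_integer_eulerLattice` (computed for the base-`p` norm of
`K_w`, transported along the identity `K_w = L_w` and the scaling `y ↦ p·y`) and the point count
`EulerLattice.natCard_point_reduction_model` (`#Ẽ(k_w) = p^f + 1 − D_f(a_p;p)`,
`#Ẽ[p^∞] = p^{v_p #Ẽ}`). [cite: BlochKato1990, Example 3.11] [cite: SilvermanAEC2009, Thm. IV.6.4 and V.2.3.1] -/
theorem exists_padicLog_eq_of_norm_eulerOperator_le [he : Fact (w.1.asIdeal.ramificationIdx (𝓞 ℚ) = 1)]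
    (hΔ : ¬ (p : ℤ) ∣ minimalDiscriminantInt W)
    (φ : Kw p L w →ₐ[ℚ_[p]] Kw p L w) (hφ : ∀ x, ‖φ x‖ = ‖x‖)
    (hφp : ∀ x : Kw p L w, ‖x‖ ≤ 1 → ‖φ x - x ^ p‖ < 1)
    {f : ℕ} (hf0 : 0 < f) (hf : Module.finrank ℚ_[p] (Kw p L w) = f)
    (hfw : w.1.asIdeal.inertiaDeg (𝓞 ℚ) = f) (hpow : ∀ x, (φ ^ f) x = x)
    (hdist : ∀ i j : ℕ, i < f → j < f → (⇑(φ ^ i) : Kw p L w → Kw p L w) = ⇑(φ ^ j) → i = j)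
    (hT : ∀ P : (W.baseChange (w.1.adicCompletion L)).toAffine.Point, p • P = 0 → P = 0)
    {y : Kw p L w}
    (hy : ‖φ (φ y) - (W.frobeniusTrace p : Kw p L w) * φ y + (p : Kw p L w) * y‖ ≤ ‖(p : Kw p L w)‖) :
    haveI := isIntegral_baseChange w.1 W
    ∃ P : (W.baseChange (w.1.adicCompletion L)).toAffine.Point,
      padicLogPointFiniteExt (NormedField.valuation : Valuation (w.1.adicCompletion L) ℝ≥0)
        (W.baseChange (w.1.adicCompletion L)) p P = Kw.toCompletion p L w y := by
  classical
  haveI hint := isIntegral_baseChange w.1 W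
  have hw : ((p : ℕ) : 𝓞 L) ∈ w.1.asIdeal := Kw.prime_mem_asIdeal w
  -- `φ` on `L_w` as a `ℚ`-algebra map
  set e := Kw.toCompletion p L w with he_def
  let φ₀ : w.1.adicCompletion L →+* w.1.adicCompletion L :=
    e.toRingHom.comp (φ.toRingHom.comp e.symm.toRingHom)
  have hφ₀ : ∀ x, φ₀ x = e (φ (e.symm x)) := fun _ => rfl
  let φK : w.1.adicCompletion L →ₐ[ℚ] w.1.adicCompletion L := φ₀.toRatAlgHom
  have hφK : ∀ x, φK x = e (φ (e.symm x)) := fun _ => rfl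
  -- unramified normalisation, isometry and Frobenius lift in Mathlib's norm
  have hdisc : ∀ x : w.1.adicCompletion L, ‖x‖ < 1 → ‖x‖ ≤ ‖(p : w.1.adicCompletion L)‖ :=
    norm_le_norm_natCast_of_norm_lt_one p L w
  have hφKn : ∀ x, ‖φK x‖ = ‖x‖ := norm_conj_eq p L w φ hφ φK hφK
  have hφKp : ∀ x : w.1.adicCompletion L, ‖x‖ ≤ 1 → ‖φK x - x ^ p‖ < 1 :=
    norm_conj_sub_pow_lt p L w φ hφp φK hφK
  -- the Euler operator on `L_w` and the Euler lattice `Λ = {‖T z‖ ≤ ‖p‖}`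
  let TK : (w.1.adicCompletion L) →+ (w.1.adicCompletion L) :=
    (φ₀.toAddMonoidHom.comp φ₀.toAddMonoidHom
      - (AddMonoidHom.mulLeft (W.frobeniusTrace p : (w.1.adicCompletion L))).comp φ₀.toAddMonoidHom)
      + AddMonoidHom.mulLeft (p : (w.1.adicCompletion L))
  have hTK : ∀ z, TK z = φK (φK z) - (W.frobeniusTrace p : (w.1.adicCompletion L)) * φK z + (p : (w.1.adicCompletion L)) * z :=
    fun _ => rfl
  let Λ : AddSubgroup (w.1.adicCompletion L) := ((NormedField.valuation : Valuation (w.1.adicCompletion L) ℝ≥0).leAddSubgroup ((NormedField.valuation : Valuation (w.1.adicCompletion L) ℝ≥0) (p : (w.1.adicCompletion L)))).comap TK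
  have hΛmem : ∀ z, z ∈ Λ ↔ ‖φK (φK z) - (W.frobeniusTrace p : (w.1.adicCompletion L)) * φK z + (p : (w.1.adicCompletion L)) * z‖ ≤ ‖(p : (w.1.adicCompletion L))‖ := by
    intro z
    change TK z ∈ (NormedField.valuation : Valuation (w.1.adicCompletion L) ℝ≥0).leAddSubgroup ((NormedField.valuation : Valuation (w.1.adicCompletion L) ℝ≥0) (p : (w.1.adicCompletion L))) ↔ _
    rw [Valuation.mem_leAddSubgroup_iff, hTK, LocalPoints.valuation_apply, LocalPoints.valuation_apply,
      ← NNReal.coe_le_coe, coe_nnnorm, coe_nnnorm]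
  -- the operator on `K_w` used by the index theorem agrees with `TK`
  have hTKw : ∀ z : Kw p L w, e (aeval (φ : Kw p L w →ₗ[ℚ_[p]] Kw p L w)
      (X ^ 2 - C ((W.frobeniusTrace p : ℤ) : ℚ_[p]) * X + C ((p : ℤ) : ℚ_[p])) z) = TK (e z) := by
    intro z
    rw [aeval_eulerPoly_apply, hTK, hφK, hφK]
    simp only [RingEquiv.symm_apply_apply, Algebra.smul_def, map_add, map_sub,
      map_mul, map_intCast, map_natCast, Int.cast_natCast]
    rfl
  -- the index of the unscaled lattice, in the base-`p` norm (`KimAtThreeEulerLatticeIndex`)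
  have hcount := natCard_point_reduction_model w.1 W hw hΔ
  rw [hfw] at hcount
  haveI := finite_point_reduction_model w.1 W
  haveI : ProperSpace (Kw p L w) := FiniteDimensional.proper ℚ_[p] (Kw p L w)
  have hd : (((Polynomial.dickson 1 (p : ℤ) f).eval (W.frobeniusTrace p) : ℤ) : ℤ_[p]) =
      (Polynomial.dickson 1 ((p : ℤ) : ℤ_[p]) f).eval ((W.frobeniusTrace p : ℤ) : ℤ_[p]) := by
    rw [← eq_intCast (Int.castRingHom ℤ_[p]), ← Polynomial.eval₂_at_apply, ← Polynomial.eval_map,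
      Polynomial.map_dickson, eq_intCast, eq_intCast]
  have hcast : (((p : ℤ) : ℤ_[p]) ^ f + 1 -
      (Polynomial.dickson 1 ((p : ℤ) : ℤ_[p]) f).eval ((W.frobeniusTrace p : ℤ) : ℤ_[p])) =
      ((Nat.card (((integralModelInt W).map (Int.castRingHom (w.1.adicCompletionIntegers L))).map (IsLocalRing.residue (w.1.adicCompletionIntegers L))).toAffine.Point : ℕ) : ℤ_[p]) := by
    have h := congrArg (Int.cast : ℤ → ℤ_[p]) hcount
    simp only [Int.cast_natCast, Int.cast_sub, Int.cast_add, Int.cast_pow, Int.cast_one] at h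
    rw [hd] at h
    rw [Int.cast_natCast]
    exact h.symm
  have hN : (((p : ℤ) : ℤ_[p]) ^ f + 1 -
      (Polynomial.dickson 1 ((p : ℤ) : ℤ_[p]) f).eval ((W.frobeniusTrace p : ℤ) : ℤ_[p])) ≠ 0 := by
    rw [hcast, Nat.cast_ne_zero]
    exact Nat.card_pos.ne'
  have hidx := relIndex_integer_eulerLattice (K := Kw p L w) φ hφ hf0 hf hpow hdist (W.frobeniusTrace p) (p : ℤ) hN
  rw [hcast] at hidx
  have hval : (((Nat.card (((integralModelInt W).map (Int.castRingHom (w.1.adicCompletionIntegers L))).map (IsLocalRing.residue (w.1.adicCompletionIntegers L))).toAffine.Point : ℕ) : ℤ_[p])).valuation = padicValNat p (Nat.card (((integralModelInt W).map (Int.castRingHom (w.1.adicCompletionIntegers L))).map (IsLocalRing.residue (w.1.adicCompletionIntegers L))).toAffine.Point) := by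
    have h := PadicInt.valuation_coe (p := p) ((Nat.card (((integralModelInt W).map (Int.castRingHom (w.1.adicCompletionIntegers L))).map (IsLocalRing.residue (w.1.adicCompletionIntegers L))).toAffine.Point : ℕ) : ℤ_[p])
    rw [PadicInt.coe_natCast, Padic.valuation_natCast] at h
    exact_mod_cast h.symm
  rw [hval, ← natCard_primaryComponent_eq_pow_padicValNat] at hidx
  -- abstract the unit ball `O = 𝒪_(K_w)` and the operator of the index theorem
  obtain ⟨O, Tadd, hshow, hO, hTadd⟩ : ∃ (O : AddSubgroup (Kw p L w)) (Tadd : Kw p L w →+ Kw p L w),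
      O.relIndex (O.comap Tadd) = Nat.card (AddCommGroup.primaryComponent (((integralModelInt W).map (Int.castRingHom (w.1.adicCompletionIntegers L))).map (IsLocalRing.residue (w.1.adicCompletionIntegers L))).toAffine.Point p) ∧
        (∀ t, t ∈ O ↔ ‖t‖ ≤ 1) ∧ ∀ t, e (Tadd t) = TK (e t) :=
    ⟨_, _, hidx, fun _ => Valued.integer.mem_iff, hTKw⟩
  clear hidx
  -- transport along `ψ : K_w → L_w`, `t ↦ p · t`
  have hp0 : (p : (w.1.adicCompletion L)) ≠ 0 := by
    rw [← map_natCast (algebraMap L (w.1.adicCompletion L)) p]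
    exact (_root_.map_ne_zero _).mpr (Nat.cast_ne_zero.mpr hp.out.ne_zero)
  have hp0w : (p : Kw p L w) ≠ 0 := fun h => hp0 (by rw [← map_natCast e p, h, map_zero])
  let ψ : Kw p L w →+ (w.1.adicCompletion L) :=
    AddMonoidHom.mk' (fun t => (p : (w.1.adicCompletion L)) * e t) (fun a b => by rw [map_add, mul_add])
  have hψ : ∀ t, ψ t = (p : (w.1.adicCompletion L)) * e t := fun _ => rfl
  have hψinj : Function.Injective ψ := fun a b h => e.injective (mul_left_cancel₀ hp0 h)
  have hψsurj : ∀ x : (w.1.adicCompletion L), ∃ t, ψ t = x := by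
    intro x
    refine ⟨e.symm (x / (p : (w.1.adicCompletion L))), ?_⟩
    rw [hψ, RingEquiv.apply_symm_apply, mul_div_assoc', mul_div_cancel_left₀ x hp0]
  have hB₁mem : ∀ x : (w.1.adicCompletion L), x ∈ ((NormedField.valuation : Valuation (w.1.adicCompletion L) ℝ≥0).leAddSubgroup ((NormedField.valuation : Valuation (w.1.adicCompletion L) ℝ≥0) (p : (w.1.adicCompletion L)))) ↔ ‖x‖ ≤ ‖(p : (w.1.adicCompletion L))‖ := by
    intro x
    rw [Valuation.mem_leAddSubgroup_iff, LocalPoints.valuation_apply, LocalPoints.valuation_apply,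
      ← NNReal.coe_le_coe, coe_nnnorm, coe_nnnorm]
  have hψmem : ∀ t, ψ t ∈ ((NormedField.valuation : Valuation (w.1.adicCompletion L) ℝ≥0).leAddSubgroup ((NormedField.valuation : Valuation (w.1.adicCompletion L) ℝ≥0) (p : (w.1.adicCompletion L)))) ↔ ‖t‖ ≤ 1 := by
    intro t
    rw [hB₁mem, hψ, norm_le_norm_iff p L w, ← he_def, map_mul, map_natCast, RingEquiv.symm_apply_apply,
      norm_mul]
    exact mul_le_iff_le_one_right (norm_pos_iff.mpr hp0w)
  have hψT : ∀ t, TK (ψ t) = ψ (Tadd t) := by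
    intro t
    rw [hψ, hψ, hTadd t, hTK, hTK]
    simp only [map_mul, map_natCast]
    ring
  have hψmemΛ : ∀ t, ψ t ∈ Λ ↔ t ∈ O.comap Tadd := by
    intro t
    change TK (ψ t) ∈ ((NormedField.valuation : Valuation (w.1.adicCompletion L) ℝ≥0).leAddSubgroup ((NormedField.valuation : Valuation (w.1.adicCompletion L) ℝ≥0) (p : (w.1.adicCompletion L)))) ↔ Tadd t ∈ O
    rw [hψT]
    exact (hψmem _).trans (hO _).symm
  have hmap : ∀ (S : AddSubgroup (w.1.adicCompletion L)) (S' : AddSubgroup (Kw p L w)),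
      (∀ t, ψ t ∈ S ↔ t ∈ S') → S'.map ψ = S := by
    intro S S' h
    ext x
    rw [AddSubgroup.mem_map]
    constructor
    · rintro ⟨t, ht, rfl⟩
      exact (h t).mpr ht
    · intro hx
      obtain ⟨t, rfl⟩ := hψsurj x
      exact ⟨t, (h t).mp hx, rfl⟩
  have hΛ : ((NormedField.valuation : Valuation (w.1.adicCompletion L) ℝ≥0).leAddSubgroup ((NormedField.valuation : Valuation (w.1.adicCompletion L) ℝ≥0) (p : (w.1.adicCompletion L)))).relIndex Λ = Nat.card (AddCommGroup.primaryComponent (((integralModelInt W).map (Int.castRingHom (w.1.adicCompletionIntegers L))).map (IsLocalRing.residue (w.1.adicCompletionIntegers L))).toAffine.Point p) := by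
    rw [← hmap ((NormedField.valuation : Valuation (w.1.adicCompletion L) ℝ≥0).leAddSubgroup ((NormedField.valuation : Valuation (w.1.adicCompletion L) ℝ≥0) (p : (w.1.adicCompletion L)))) O (fun t => (hψmem t).trans (hO t).symm), ← hmap Λ (O.comap Tadd) hψmemΛ,
      AddSubgroup.relIndex_map_map_of_injective _ _ hψinj]
    exact hshow
  -- `y` lies in the Euler lattice
  have hyΛ : e y ∈ Λ := by
    change TK (e y) ∈ ((NormedField.valuation : Valuation (w.1.adicCompletion L) ℝ≥0).leAddSubgroup ((NormedField.valuation : Valuation (w.1.adicCompletion L) ℝ≥0) (p : (w.1.adicCompletion L))))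
    rw [hB₁mem, ← hTKw y, norm_le_norm_iff p L w, ← he_def, RingEquiv.symm_apply_apply, map_natCast]
    convert hy using 2
    rw [aeval_eulerPoly_apply]
    simp only [Algebra.smul_def, map_intCast, map_natCast, Int.cast_natCast]
    rfl
  exact exists_padicLog_eq_of_mem_eulerLattice w.1 W hw hΔ hdisc φK hφKn hφKp hT Λ hΛmem hΛ hyΛ

/-- **The lattice lemma as an equivalence** (`K_w` currency): under the hypotheses of
`exists_padicLog_eq_of_norm_eulerOperator_le`, `y ∈ K_w` is a formal-group logarithm `log_ω P`,
`P ∈ E(L_w)`, iff `‖φφy − a_p·φy + p·y‖ ≤ ‖p‖`; that is **`log_ω E(L_w) = E_p(φ)⁻¹𝒪_w`** with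
`E_p(X) = X² − a_pX + p` — the `E`-side of the Bloch–Kato local computation at a good prime.
[cite: BlochKato1990, Example 3.11] [cite: SilvermanAEC2009, Thm. IV.6.4 and V.2.3.1] -/
theorem exists_padicLog_eq_iff_norm_eulerOperator_le [he : Fact (w.1.asIdeal.ramificationIdx (𝓞 ℚ) = 1)]
    (hΔ : ¬ (p : ℤ) ∣ minimalDiscriminantInt W)
    (φ : Kw p L w →ₐ[ℚ_[p]] Kw p L w) (hφ : ∀ x, ‖φ x‖ = ‖x‖)
    (hφp : ∀ x : Kw p L w, ‖x‖ ≤ 1 → ‖φ x - x ^ p‖ < 1)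
    {f : ℕ} (hf0 : 0 < f) (hf : Module.finrank ℚ_[p] (Kw p L w) = f)
    (hfw : w.1.asIdeal.inertiaDeg (𝓞 ℚ) = f) (hpow : ∀ x, (φ ^ f) x = x)
    (hdist : ∀ i j : ℕ, i < f → j < f → (⇑(φ ^ i) : Kw p L w → Kw p L w) = ⇑(φ ^ j) → i = j)
    (hT : ∀ P : (W.baseChange (w.1.adicCompletion L)).toAffine.Point, p • P = 0 → P = 0)
    (y : Kw p L w) :
    haveI := isIntegral_baseChange w.1 W
    (∃ P : (W.baseChange (w.1.adicCompletion L)).toAffine.Point,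
      padicLogPointFiniteExt (NormedField.valuation : Valuation (w.1.adicCompletion L) ℝ≥0)
        (W.baseChange (w.1.adicCompletion L)) p P = Kw.toCompletion p L w y) ↔
    ‖φ (φ y) - (W.frobeniusTrace p : Kw p L w) * φ y + (p : Kw p L w) * y‖ ≤ ‖(p : Kw p L w)‖ := by
  refine ⟨fun ⟨P, hP⟩ => ?_, fun hy =>
    exists_padicLog_eq_of_norm_eulerOperator_le p L w W hΔ φ hφ hφp hf0 hf hfw hpow hdist hT hy⟩
  have h := norm_eulerOperator_padicLog_le p L w W hΔ φ hφ hφp P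
  rwa [hP, RingEquiv.symm_apply_apply] at h

end Summit.BirchSwinnertonDyer.BirchSwinnertonDyer.Theorems.KimAtThreeEulerLatticeOfFrobenius
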